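import Literature.NumberTheory.LFunctions.KowalskiMichelPeterssonBoundProof
import HarnessLib

/-!
# Kowalski–Michel's (23) for the off-diagonal term `J(m, n)` itself, from Weil's bound alone

E. Kowalski, P. Michel, *A lower bound for the rank of `J_0(q)`*, Acta Arith. 94 (2000), §2.4.2,
p. 312 [held: paper:doi-10-4064-aa-94-4-303-343, PDF p. 10], read on the page:

  "`J(l₁, l₂) = (2π/q) ∑_{r ≥ 1} r⁻¹ S(l₁, l₂; qr) J₁(4π √(l₁ l₂)/(qr))`.  The trivial bound for
  this, from Weil's bound for Kloosterman sums and `J₁(x) ≪ x`, is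
  (23) `J(l₁, l₂) ≪_ε (l₁ l₂)^{1/2+ε} q^{−3/2}`."

The companion file `KowalskiMichelPeterssonBoundProof.lean` proves the termwise bound
`norm_petKloostermanTerm_le` and, from Petersson's formula AS PRINTED
(`kowalskiMichel2000_peterssonFormula`, whose statement includes the convergence of the `r`-series)
plus Weil's bound, the repaired harmonic-moment bound `kowalskiMichel2000_peterssonBound`
(`peterssonBound_of_peterssonFormula`).  This file records the two statements about `J` itself
that do NOT need Petersson's formula — only Weil's bound `weil_kloosterman_bound` (Iwaniec (2.25)):

* `summable_norm_petKloostermanTerm_of_weil` — on the range `¬ (q ∣ m ∧ q ∣ n)` the `r`-series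
  defining `J(m, n)` converges absolutely (the convergence clause typed inside
  `kowalskiMichel2000_peterssonFormula` is, on this range, a CONSEQUENCE of Weil's bound);
* `norm_petJ_le_of_weil` — **(23) verbatim, as a bound on `J`**: for every `ε > 0` there is `C`
  with `‖J(m, n)‖ ≤ C (mn)^{1/2+ε} q^{−3/2}` for all primes `q` and all `m, n ≥ 1` with
  `¬ (q ∣ m ∧ q ∣ n)`; one may take `C = 8π² C_{θ/4} ∑_{r ≥ 1} r^{−1−θ/4}`, `θ = min(ε, 1)`.

These are the forms consumed by arguments that bound the Kloosterman–Bessel part of a harmonic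
moment directly (before or without invoking the formula for `∑ʰ λ_f(m)λ_f(n)`).  No definition, no
named fact.

## References

* E. Kowalski, P. Michel, Acta Arith. 94 (2000), §2.4.2 p. 312 (23). [KowalskiMichel2000]
* H. Iwaniec, *Spectral methods of automorphic forms*, 2nd ed. (2002), (2.25). [Iwaniec2002]
* G. H. Hardy, E. M. Wright, *An Introduction to the Theory of Numbers*, Thm 315. [HardyWright2008]
-/

noncomputable section

open scoped Real

namespace Literature.NumberTheory.LFunctions.KowalskiMichel2000

/-- `(m, n) ≤ √(mn)` for `m, n ≥ 1` (from `(m, n) ≤ m` and `(m, n) ≤ n`). [folklore] -/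
private theorem gcd_le_sqrt_mul {m n : ℕ} (hm : m ≠ 0) (hn : n ≠ 0) :
    ((m.gcd n : ℕ) : ℝ) ≤ Real.sqrt ((m : ℝ) * n) := by
  have h1 : m.gcd n ≤ m := Nat.le_of_dvd (Nat.pos_of_ne_zero hm) (Nat.gcd_dvd_left m n)
  have h2 : m.gcd n ≤ n := Nat.le_of_dvd (Nat.pos_of_ne_zero hn) (Nat.gcd_dvd_right m n)
  have h : ((m.gcd n : ℕ) : ℝ) * (m.gcd n : ℕ) ≤ (m : ℝ) * n := by
    exact_mod_cast Nat.mul_le_mul h1 h2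
  refine (Real.le_sqrt (Nat.cast_nonneg _) (by positivity)).mpr ?_
  rw [sq]
  exact h

/-- **Absolute convergence of the `r`-series of `J(m, n)` from Weil's bound** (Kowalski–Michel
p. 312: "the trivial bound for this, from Weil's bound for Kloosterman sums and `J₁(x) ≪ x`"):
for `q` prime and `m ≥ 1`, `n` with `¬ (q ∣ m ∧ q ∣ n)`, `∑_r ‖r⁻¹ S(m,n;qr) J₁(4π√(mn)/(qr))‖ < ∞`
(termwise `≪ r^{−5/4}` by `norm_petKloostermanTerm_le` with `θ = 1`).
[cite: KowalskiMichel2000, §2.4.2 p. 312 (23)] -/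
theorem summable_norm_petKloostermanTerm_of_weil (hW : weil_kloosterman_bound) {q : ℕ} [NeZero q]
    (hq : q.Prime) {m n : ℕ} (hm : 1 ≤ m) (hmn : ¬ (q ∣ m ∧ q ∣ n)) :
    Summable (fun r : ℕ ↦ ‖petKloostermanTerm q m n r‖) := by
  obtain ⟨C, -, hC⟩ :=
    Literature.NumberTheory.Sieve.exists_card_divisors_le_mul_rpow' (by norm_num : (0 : ℝ) < 1 / 4)
  have hZ : Summable (fun r : ℕ ↦ (r : ℝ) ^ (-(1 + 1 / 4 : ℝ))) :=
    Real.summable_nat_rpow.mpr (by norm_num)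
  refine Summable.of_nonneg_of_le (fun _ ↦ norm_nonneg _)
    (fun r ↦ norm_petKloostermanTerm_le hW hq hm hmn one_pos le_rfl (fun r ↦ hC r) r) ?_
  exact hZ.mul_left _

/-- **Kowalski–Michel 2000, (23), for `J(m, n)` itself, PROVED from Weil's bound:**
"`J(l₁, l₂) ≪_ε (l₁ l₂)^{1/2+ε} q^{−3/2}`" — for every `ε > 0` there is `C` such that for all
primes `q` and all `m, n ≥ 1` with `¬ (q ∣ m ∧ q ∣ n)` (the paper's range "`(m, q) = 1`",
p. 312), `‖J(m, n)‖ ≤ C (mn)^{1/2+ε} q^{−3/2}`.  Proof: `‖J‖ ≤ (2π/q) ∑_r ‖r⁻¹ S J₁‖`, the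
termwise bound `norm_petKloostermanTerm_le` (`θ = min(ε,1)`, divisor-bound constant `C_{θ/4}`),
`∑_r r^{−1−θ/4} = Z < ∞`, `(m,n)^{θ/2} √(mn) ≤ (mn)^{1/2+θ/4} ≤ (mn)^{1/2+ε}`; `C = 8π² C_{θ/4} Z`.
The only unproved input is Weil's bound (Iwaniec (2.25)); Petersson's formula is not used.
[cite: KowalskiMichel2000, §2.4.2 p. 312 (23)] -/
theorem norm_petJ_le_of_weil (hW : weil_kloosterman_bound) {ε : ℝ} (hε : 0 < ε) :
    ∃ C : ℝ, ∀ (q : ℕ) [NeZero q], q.Prime → ∀ m n : ℕ, 1 ≤ m → 1 ≤ n →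
      ¬ (q ∣ m ∧ q ∣ n) →
        ‖petJ q m n‖ ≤ C * (((m : ℝ) * n) ^ (1 / 2 + ε)) * (q : ℝ) ^ (-(3 / 2 : ℝ)) := by
  -- constants: `θ = min ε 1`, `C₁` = divisor-bound constant at `θ/4`, `Z = ∑ r^{−1−θ/4}`
  obtain ⟨θ, hθ, hθ1, hθε⟩ : ∃ θ : ℝ, 0 < θ ∧ θ ≤ 1 ∧ θ ≤ ε :=
    ⟨min ε 1, lt_min hε one_pos, min_le_right _ _, min_le_left _ _⟩
  obtain ⟨C₁, hC₁1, hC₁⟩ :=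
    Literature.NumberTheory.Sieve.exists_card_divisors_le_mul_rpow' (by positivity : 0 < θ / 4)
  have hC₁0 : (0 : ℝ) ≤ C₁ := zero_le_one.trans hC₁1
  have hZs : Summable (fun r : ℕ ↦ (r : ℝ) ^ (-(1 + θ / 4))) :=
    Real.summable_nat_rpow.mpr (by linarith)
  obtain ⟨Z, hZ⟩ : ∃ Z : ℝ, Z = ∑' r : ℕ, (r : ℝ) ^ (-(1 + θ / 4)) := ⟨_, rfl⟩
  have hZ0 : 0 ≤ Z := hZ ▸ tsum_nonneg fun r ↦ Real.rpow_nonneg (Nat.cast_nonneg _) _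
  refine ⟨8 * π ^ 2 * C₁ * Z, fun q _ hq m n hm hn hmn ↦ ?_⟩
  have hm0 : m ≠ 0 := by omega
  have hn0 : n ≠ 0 := by omega
  have hq0 : (0 : ℝ) < q := by exact_mod_cast hq.pos
  have hmn0 : (0 : ℝ) < (m : ℝ) * n := by positivity
  have hmn1 : (1 : ℝ) ≤ (m : ℝ) * n := by
    have : 1 ≤ m * n := Nat.one_le_iff_ne_zero.mpr (mul_ne_zero hm0 hn0)
    exact_mod_cast this
  -- the termwise bound, summed
  obtain ⟨A, hA⟩ : ∃ A : ℝ, A = 4 * π * C₁ * Real.sqrt ((m : ℝ) * n) * (q : ℝ) ^ (-(1 / 2 : ℝ)) *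
      ((m.gcd n : ℕ) : ℝ) ^ (θ / 2) := ⟨_, rfl⟩
  have hterm : ∀ r : ℕ, ‖petKloostermanTerm q m n r‖ ≤ A * (r : ℝ) ^ (-(1 + θ / 4)) :=
    fun r ↦ hA ▸ norm_petKloostermanTerm_le hW hq hm hmn hθ hθ1 (fun k ↦ hC₁ k) r
  have hbs : Summable (fun r : ℕ ↦ A * (r : ℝ) ^ (-(1 + θ / 4))) := hZs.mul_left A
  have has : Summable (fun r : ℕ ↦ ‖petKloostermanTerm q m n r‖) :=
    Summable.of_nonneg_of_le (fun _ ↦ norm_nonneg _) hterm hbs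
  have htsum : ∑' r : ℕ, ‖petKloostermanTerm q m n r‖ ≤ A * Z := by
    calc ∑' r : ℕ, ‖petKloostermanTerm q m n r‖
        ≤ ∑' r : ℕ, A * (r : ℝ) ^ (-(1 + θ / 4)) := Summable.tsum_le_tsum hterm has hbs
      _ = A * Z := by rw [tsum_mul_left, hZ]
  -- `‖J(m,n)‖ = (2π/q) ‖∑_r …‖ ≤ (2π/q) ∑_r ‖…‖`
  have hnorm : ‖(2 * π / q : ℂ)‖ = 2 * π / q := by
    rw [norm_div, norm_mul, Complex.norm_real, Complex.norm_natCast, Real.norm_eq_abs,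
      abs_of_pos Real.pi_pos, Complex.norm_two]
  have hJ : ‖petJ q m n‖ ≤ 2 * π / q * (A * Z) := by
    rw [petJ_def, norm_mul, hnorm]
    exact mul_le_mul_of_nonneg_left ((norm_tsum_le_tsum_norm has).trans htsum) (by positivity)
  -- `√(mn) (m,n)^{θ/2} ≤ (mn)^{1/2+ε}`
  have hkey : Real.sqrt ((m : ℝ) * n) * ((m.gcd n : ℕ) : ℝ) ^ (θ / 2) ≤
      ((m : ℝ) * n) ^ (1 / 2 + ε) := by
    have hdle : ((m.gcd n : ℕ) : ℝ) ^ (θ / 2) ≤ (Real.sqrt ((m : ℝ) * n)) ^ (θ / 2) :=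
      Real.rpow_le_rpow (Nat.cast_nonneg _) (gcd_le_sqrt_mul hm0 hn0) (by positivity)
    calc Real.sqrt ((m : ℝ) * n) * ((m.gcd n : ℕ) : ℝ) ^ (θ / 2)
        ≤ Real.sqrt ((m : ℝ) * n) * (Real.sqrt ((m : ℝ) * n)) ^ (θ / 2) :=
          mul_le_mul_of_nonneg_left hdle (Real.sqrt_nonneg _)
      _ = ((m : ℝ) * n) ^ (1 / 2 + θ / 4) := by
          rw [Real.sqrt_eq_rpow, ← Real.rpow_mul hmn0.le, ← Real.rpow_add hmn0]
          congr 1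
          ring
      _ ≤ ((m : ℝ) * n) ^ (1 / 2 + ε) := Real.rpow_le_rpow_of_exponent_le hmn1 (by linarith)
  -- final algebra: `(2π/q) · 4π C₁ √(mn) q^{−1/2} (m,n)^{θ/2} · Z = 8π² C₁ Z · √(mn)(m,n)^{θ/2} · q^{−3/2}`
  have hq32 : 2 * π / q * (q : ℝ) ^ (-(1 / 2 : ℝ)) = 2 * π * (q : ℝ) ^ (-(3 / 2 : ℝ)) := by
    rw [div_eq_mul_inv, ← Real.rpow_neg_one, mul_assoc, ← Real.rpow_add hq0]
    norm_num
  have hK0 : 0 ≤ 8 * π ^ 2 * C₁ * Z := mul_nonneg (mul_nonneg (by positivity) hC₁0) hZ0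
  calc ‖petJ q m n‖ ≤ 2 * π / q * (A * Z) := hJ
    _ = (2 * π / q * (q : ℝ) ^ (-(1 / 2 : ℝ))) * (4 * π * C₁ * Z) *
          (Real.sqrt ((m : ℝ) * n) * ((m.gcd n : ℕ) : ℝ) ^ (θ / 2)) := by
        rw [hA]; ring
    _ = 8 * π ^ 2 * C₁ * Z * (Real.sqrt ((m : ℝ) * n) * ((m.gcd n : ℕ) : ℝ) ^ (θ / 2)) *
          (q : ℝ) ^ (-(3 / 2 : ℝ)) := by
        rw [hq32]; ring
    _ ≤ 8 * π ^ 2 * C₁ * Z * ((m : ℝ) * n) ^ (1 / 2 + ε) * (q : ℝ) ^ (-(3 / 2 : ℝ)) :=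
        mul_le_mul_of_nonneg_right (mul_le_mul_of_nonneg_left hkey hK0) (Real.rpow_nonneg hq0.le _)

end Literature.NumberTheory.LFunctions.KowalskiMichel2000
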